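import Literature.NumberTheory.Automorphic.UnitaryGroupRankOneCharpolySections     -- ★ F2b: `exists_nhds_class` (class map open at every point of `U(J₂)(K)`)
import Literature.NumberTheory.Automorphic.UnitaryGroupInertPlaceHyperbolicBasis  -- ★ `galAdicCompletionMap_galAdicCompletionMap_of_smul_eq` (σ_w is an involution)
import Literature.NumberTheory.Automorphic.LocalUnitaryGroupCongr                 -- ★ `localNonsplitEquiv` (one-place model)
import Literature.NumberTheory.GelbartRogawski1991.UnitaryDualPairThetaKernelCM    -- ★ `imagUnit`, `complexConj_imagUnit`, `imagUnit_ne_zero` (a trace-zero unit of `L`)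
import HarnessLib

/-!
# The class map `(tr, det)` of `U(Φ₂)(L⁺_v)` is OPEN at every point, at a NON-SPLIT finite place `v` (saturation, rank one, CM carrier)
(Langlands–Shelstad, *Descent for transfer factors* §2.2 p. 11; transport of ★ `UnitaryGroupRankOneCharpolySections` along the one-place model)

Topic `NumberTheory/Automorphic`; namespace `Literature.NumberTheory.Automorphic.UnitaryGroup`.  THEOREMS ONLY (no definition, no instance, no notation,
no named fact, no `sorry`).  Cell `pub/hodgecm-mathlib` (D-0151), crux H413 = stmt-HodgeConjecture-24833, F0∕P3a road «D-N6-ns», floor-2 line «N6nsGerm», stub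
`stub_N6nsGlue` SATURATION HALF (LEAD F0P3a-plan (g9) WORD T8-55 → B-p08 (g26)), census file F4 (part 1 = the CM transport).  HONEST LABEL: HC_CM is proved
only modulo the 2 remaining named inputs (hLiu418, h413) until rung 0 closes; this file proves no letter.

THE MATHEMATICS.  At a non-split `v` (`w` the place of `L` over `v`, `c • w = w`) the one-place model ★ `localNonsplitEquiv : U(Φ₂)(L⁺_v) ≃ₜ* U(σ_w, Φ₂)(L_w)`
reads matrices at `w` (entrywise `Pi.evalRingHom _ w`, an INJECTIVE continuous ring map `∏_{w′∣v} L_{w′} → L_w` since `w` is the only place above `v`),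
so the class `(tr, det)` over `∏ L_{w′}` is read at `w` too.  ★ `exists_nhds_class` (F2b) for the field `L_w` (valued, hence a topological field with
continuous inversion, non-discrete, `T₂`), the continuous involution `σ_w` (★ `galAdicCompletionMap_galAdicCompletionMap_of_smul_eq`), `2 ≠ 0` (characteristic `0`),
and the anti-invariant unit `ν₀ = √(−Δ)` (★ `imagUnit`) then transports: **for every `A ∈ U(Φ₂)(L⁺_v)` and every open `V ∋ A` there is a neighbourhood `W` of
`(tr A, det A)` in `(∏ L_{w′})²` such that every `g ∈ U(Φ₂)(L⁺_v)` with `(tr g, det g) ∈ W` has a class-mate `g′ ∈ V`** (`exists_nhds_class_local_two_nonsplit`).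

## References
* [LanglandsShelstad1990Descent] R. P. Langlands, D. Shelstad, *Descent for transfer factors*, Progr. Math. 87 (1990), §2.2 Lemma 2.2.A p. 11.
* [Rogawski1990] J. D. Rogawski, *Automorphic Representations of Unitary Groups in Three Variables*, Ann. of Math. Stud. 123 (1990), §3.1 p. 19, §1.9 p. 8.
* [PlatonovRapinchuk1994] V. Platonov, A. Rapinchuk, *Algebraic Groups and Number Theory* (1994), §5.1 (local points of unitary groups at non-split places).
-/

set_option autoImplicit false

noncomputable section

open Matrix Set Filter Topology NumberField IsDedekindDomain
open scoped MatrixGroups Valued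

namespace Literature.NumberTheory.Automorphic.UnitaryGroup

open Literature.NumberTheory.Automorphic
open Literature.NumberTheory.GelbartRogawski1991.UnitaryDualPair (imagUnit complexConj_imagUnit imagUnit_ne_zero)

section Wrapper

variable {K : Type*} [Field K] [TopologicalSpace K] [IsTopologicalRing K] [ContinuousInv₀ K] [T1Space K] {σ : K →+* K}

/-- ★ `exists_nhds_class` for a form `J` EQUAL to `antidiag(1,1)` (the shape in which `placeForm Φ₂ w` arrives). [cite: LanglandsShelstad1990Descent, §2.2 p. 11] -/
theorem exists_nhds_class_of_form_eq (hσ : ∀ x, σ (σ x) = x) (hσc : Continuous σ) (h2 : (2 : K) ≠ 0) {ν₀ : K} (hν₀ : σ ν₀ = -ν₀) (hν₀0 : ν₀ ≠ 0)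
    [(𝓝[≠] (0 : K)).NeBot] {J : Matrix (Fin 2) (Fin 2) K} (hJ : J = !![(0 : K), 1; 1, 0]) (A : ↥(unitaryGroupOfForm σ J))
    {V : Set ↥(unitaryGroupOfForm σ J)} (hVo : IsOpen V) (hAV : A ∈ V) :
    ∃ W ∈ 𝓝 (((A : GL (Fin 2) K).val.trace, (A : GL (Fin 2) K).val.det)),
      ∀ g : ↥(unitaryGroupOfForm σ J), (((g : GL (Fin 2) K).val.trace, (g : GL (Fin 2) K).val.det)) ∈ W →
        ∃ g' ∈ V, (g' : GL (Fin 2) K).val.trace = (g : GL (Fin 2) K).val.trace ∧ (g' : GL (Fin 2) K).val.det = (g : GL (Fin 2) K).val.det := by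
  subst hJ
  exact exists_nhds_class hσ hσc h2 hν₀ hν₀0 A hVo hAV

end Wrapper

section CM

variable (L : Type) [Field L] [NumberField L] [IsCMField L] (v : HeightOneSpectrum (𝓞 ↥(maximalRealSubfield L)))
  (w : PlacesOver L v) (hw : IsCMField.complexConj L • w.1 = w.1)

omit [IsCMField L] in
/-- `Φ₂` read over `L_w` IS `antidiag(1, 1)`. [cite: Rogawski1990, §1.9 p. 8] -/
theorem placeForm_antidiagTwo_eq :
    placeForm (Matrix.of fun i j : Fin 2 => if i.val + j.val + 1 = 2 then (1 : L) else 0) w.1 = !![(0 : w.1.adicCompletion L), 1; 1, 0] := by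
  ext i j
  fin_cases i <;> fin_cases j <;> simp [placeForm, Matrix.map_apply]

include hw in
/-- At a non-split `v`, evaluation at `w` is injective on `∏_{w′ ∣ v} L_{w′}` (there is only one place above `v`). [cite: PlatonovRapinchuk1994, §5.1] -/
theorem eval_injective_of_smul_eq : Function.Injective (Pi.evalRingHom (fun w' : PlacesOver L v => w'.1.adicCompletion L) w) := by
  haveI : Subsingleton (PlacesOver L v) :=
    PlacesOver.subsingleton_of_smul_eq (IsCMField.complexConj L) (IsCMField.complexConj_ne_one L) w hw
  intro x y h
  funext w'
  rw [Subsingleton.elim w' w]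
  exact h

include w hw in
/-- **THE CLASS MAP `(tr, det)` OF `U(Φ₂)(L⁺_v)` IS OPEN AT EVERY POINT, `v` NON-SPLIT.**  For every `A ∈ U(Φ₂)(L⁺_v)` and every OPEN `V ∋ A` there is a
neighbourhood `W` of `(tr A, det A)` in `(∏_{w′∣v} L_{w′})²` such that every `g ∈ U(Φ₂)(L⁺_v)` whose class lies in `W` has a class-mate `g′ ∈ V`
(`tr g′ = tr g`, `det g′ = det g`).  Transport of ★ `exists_nhds_class` along ★ `localNonsplitEquiv`. [cite: LanglandsShelstad1990Descent, §2.2 Lemma 2.2.A p. 11]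
[cite: PlatonovRapinchuk1994, §5.1] -/
theorem exists_nhds_class_local_two_nonsplit
    (A : ↥(«local» L (IsCMField.complexConj L) 2 (Matrix.of fun i j : Fin 2 => if i.val + j.val + 1 = 2 then (1 : L) else 0) v))
    {V : Set ↥(«local» L (IsCMField.complexConj L) 2 (Matrix.of fun i j : Fin 2 => if i.val + j.val + 1 = 2 then (1 : L) else 0) v)}
    (hVo : IsOpen V) (hAV : A ∈ V) :
    ∃ W ∈ 𝓝 (((A : GL (Fin 2) (LocalRing L v)).val.trace, (A : GL (Fin 2) (LocalRing L v)).val.det)),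
      ∀ g : ↥(«local» L (IsCMField.complexConj L) 2 (Matrix.of fun i j : Fin 2 => if i.val + j.val + 1 = 2 then (1 : L) else 0) v),
        (((g : GL (Fin 2) (LocalRing L v)).val.trace, (g : GL (Fin 2) (LocalRing L v)).val.det)) ∈ W →
        ∃ g' ∈ V, (g' : GL (Fin 2) (LocalRing L v)).val.trace = (g : GL (Fin 2) (LocalRing L v)).val.trace ∧
          (g' : GL (Fin 2) (LocalRing L v)).val.det = (g : GL (Fin 2) (LocalRing L v)).val.det := by
  -- the field `K = L_w`, as a non-trivially normed field (same topology), its involution `σ_w`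
  letI : NontriviallyNormedField (w.1.adicCompletion L) := Valued.toNontriviallyNormedField (w.1.adicCompletion L) (WithZero (Multiplicative ℤ))
  set σw := galAdicCompletionMap (L := L) (IsCMField.complexConj L) hw with hσw_def
  have hσ : ∀ x, σw (σw x) = x :=
    galAdicCompletionMap_galAdicCompletionMap_of_smul_eq (IsCMField.complexConj L) w (IsCMField.complexConj_ne_one L) hw
  have hσc : Continuous σw := continuous_galAdicCompletionMap L (IsCMField.complexConj L) hw
  have hinj : Function.Injective (algebraMap L (w.1.adicCompletion L)) := (algebraMap L (w.1.adicCompletion L)).injective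
  haveI : CharZero (w.1.adicCompletion L) := charZero_of_injective_algebraMap hinj
  have h2 : (2 : w.1.adicCompletion L) ≠ 0 := two_ne_zero
  -- the anti-invariant unit `ν₀ = √(−Δ)` read in `L_w`
  have hν₀ : σw (algebraMap L (w.1.adicCompletion L) (imagUnit L)) = -(algebraMap L (w.1.adicCompletion L) (imagUnit L)) := by
    have h := galAdicCompletionMap_coe (L := L) (IsCMField.complexConj L) hw (imagUnit L)
    rw [show ((IsCMField.complexConj L) • imagUnit L : L) = -imagUnit L from complexConj_imagUnit L] at h
    rw [hσw_def]
    show σw _ = _  -- keep the statement in `algebraMap` form; the coercion `↑x` IS `algebraMap L L_w x`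
    change galAdicCompletionMap (L := L) (IsCMField.complexConj L) hw ((imagUnit L : L) : w.1.adicCompletion L) =
      -(((imagUnit L : L)) : w.1.adicCompletion L)
    rw [h]
    change algebraMap L (w.1.adicCompletion L) (-imagUnit L) = -(algebraMap L (w.1.adicCompletion L) (imagUnit L))
    exact map_neg _ _
  have hν₀0 : algebraMap L (w.1.adicCompletion L) (imagUnit L) ≠ 0 := by
    have h := hinj.ne (imagUnit_ne_zero L)
    rwa [map_zero] at h
  -- the one-place model and its class formula
  set e := localNonsplitEquiv (IsCMField.complexConj L) (Matrix.of fun i j : Fin 2 => if i.val + j.val + 1 = 2 then (1 : L) else 0)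
    (IsCMField.complexConj_ne_one L) w hw with he_def
  set ev := Pi.evalRingHom (fun w' : PlacesOver L v => w'.1.adicCompletion L) w with hev_def
  have hcoe : ∀ g : ↥(«local» L (IsCMField.complexConj L) 2 (Matrix.of fun i j : Fin 2 => if i.val + j.val + 1 = 2 then (1 : L) else 0) v),
      ((e g : GL (Fin 2) (w.1.adicCompletion L))).val = ((g : GL (Fin 2) (LocalRing L v))).val.map ev := fun g => rfl
  have htr : ∀ g : ↥(«local» L (IsCMField.complexConj L) 2 (Matrix.of fun i j : Fin 2 => if i.val + j.val + 1 = 2 then (1 : L) else 0) v),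
      ((e g : GL (Fin 2) (w.1.adicCompletion L))).val.trace = ev ((g : GL (Fin 2) (LocalRing L v))).val.trace := fun g => by
    rw [hcoe, Matrix.trace_fin_two, Matrix.trace_fin_two, Matrix.map_apply, Matrix.map_apply, map_add]
  have hdet : ∀ g : ↥(«local» L (IsCMField.complexConj L) 2 (Matrix.of fun i j : Fin 2 => if i.val + j.val + 1 = 2 then (1 : L) else 0) v),
      ((e g : GL (Fin 2) (w.1.adicCompletion L))).val.det = ev ((g : GL (Fin 2) (LocalRing L v))).val.det := fun g => by
    rw [hcoe, ← RingHom.mapMatrix_apply, ← RingHom.map_det]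
  -- transport: `e '' V` is open and contains `e A`
  have hVo' : IsOpen (e '' V) := e.toHomeomorph.isOpenMap V hVo
  obtain ⟨WK, hWK, hWKp⟩ := exists_nhds_class_of_form_eq hσ hσc h2 hν₀ hν₀0 (placeForm_antidiagTwo_eq L v w) (e A) hVo' ⟨A, hAV, rfl⟩
  have hevc : Continuous ev := continuous_apply w
  refine ⟨(fun q : LocalRing L v × LocalRing L v => (ev q.1, ev q.2)) ⁻¹' WK,
    ((hevc.comp continuous_fst).prodMk (hevc.comp continuous_snd)).continuousAt.preimage_mem_nhds ?_, fun g hg => ?_⟩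
  · show WK ∈ 𝓝 (ev ((A : GL (Fin 2) (LocalRing L v))).val.trace, ev ((A : GL (Fin 2) (LocalRing L v))).val.det)
    rw [← htr, ← hdet]
    exact hWK
  rw [Set.mem_preimage] at hg
  obtain ⟨u', hu'V, htr', hdet'⟩ := hWKp (e g) (by rw [htr, hdet]; exact hg)
  obtain ⟨g', hg'V, rfl⟩ := hu'V
  refine ⟨g', hg'V, eval_injective_of_smul_eq L v w hw ?_, eval_injective_of_smul_eq L v w hw ?_⟩
  · rw [← htr, ← htr]; exact htr'
  · rw [← hdet, ← hdet]; exact hdet'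

end CM

end Literature.NumberTheory.Automorphic.UnitaryGroup

end
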